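import Literature.Analysis.FluidPDE.SlabPressureNormalization
import Literature.Analysis.FluidPDE.SlabSuitableCompactness
import Literature.Analysis.FluidPDE.LocalTypeIReverse
import Literature.Analysis.FluidPDE.LocalTypeIPersistenceHolds
import Literature.Analysis.FluidPDE.ESSLocalHolderBlowupLocalEnergy
import HarnessLib

/-!
# Compactness of Type-I-bounded suitable weak solutions on the backward slab, sharp form (Albritton–Barker 2019)

Analysis/FluidPDE proofs-only file (theorems only: no definitions, no named facts, no `sorry`)
over `Literature/Analysis/FluidPDE/LocalTypeI.lean` (D. Albritton, T. Barker, *On local Type I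
singularities of the Navier–Stokes equations and Liouville theorems*, J. Math. Fluid Mech. 21
(2019) = arXiv:1811.00502, §1, Lemma 2.2, Prop. 2.3, §3).

**The engine of A–B §3 on the whole slab, with the sharp bound on `𝐈`.**  Let `(v_k, q_k)` be
suitable weak solutions of Navier–Stokes (`ν = 1`, `f = 0`) on the backward slab
`ℝ³ × ℝ₋ = (-∞, 0) × ℝ³` with weak spatial gradients `G_k` and uniformly bounded Albritton–Barker
quantity `𝐈(v_k, q_k, G_k) ≤ I < ∞`.  Then (`slab_typeI_compactness_sharp`) along a subsequence
`σ` the `v_{σ j}` converge in `L³(Q(0, R))` for every `R > 0` to a suitable weak solution `(u, p)`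
on the whole slab, with a weak spatial gradient `H` and `𝐈(u, p, H) ≤ I`; and if moreover
`limsup_j ‖v_{σ j}‖_{L^∞(Q(0,R))} = ∞` for every `R > 0`, the space–time origin is a backward
singular point of `u`.  This is `slab_typeI_compactness` of
`Literature/Analysis/FluidPDE/SlabTypeICompactness.lean` (A–B §3: Lemma 2.2 applied to the
sequence with the uniform estimate (3.3), Prop. 2.3 for the singularity) with the bound `𝐈 ≤ 4 I`
of that file sharpened to `𝐈 ≤ I`, which is what A–B's lower semicontinuity remark ("(3.6)
follows from (3.3)") actually gives: on a fixed admissible ball `Q(z, r)` the four scaled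
quantities `A_j, C_j, D_j, E_j` of the approximants have `A_j + C_j + D_j + E_j ≤ I`; passing to a
further subsequence along which all four converge in the compact space `ℝ≥0∞` (limits
`a + c + d + e ≤ I`), the lower semicontinuity lemmas `cknAEss_le_of_tendsto_eLpNorm`,
`cknC_le_of_tendsto_eLpNorm`, `cknDOsc_le_of_tendsto_weakly`, `cknE_le_of_tendsto_eLpNorm`
applied to tails of that subsequence give `A(u) ≤ a`, `C(u) ≤ c`, `D(p) ≤ d`, `E(H) ≤ e`
(superadditivity of `liminf`), whence `(A + C + D + E)(Q(z, r)) ≤ I` for the limit.  Steps 0–3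
and 5 (pressure normalisation, `slab_suitableCompactness`, gluing of suitability and of the
gradient along the exhaustion, persistence of singularities) are those of the unsharpened file.

## References

* D. Albritton, T. Barker, J. Math. Fluid Mech. 21 (2019), no. 43 = arXiv:1811.00502, §1,
  Lemma 2.2, Prop. 2.3, §3. [AlbrittonBarker2019]
-/

noncomputable section

open MeasureTheory Set Function Filter Topology TopologicalSpace Metric
open scoped NNReal ENNReal

namespace Literature.Analysis.FluidPDE

section LiminfTools

/-- **A lower semicontinuous functional is bounded by any subsequential limit.**  If a quantity
`A ∈ ℝ≥0∞` satisfies `A ≤ M` whenever a subsequence of `(a_j)` is bounded by `M` (the form in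
which the lower semicontinuity lemmas for Albritton–Barker's `A, C, D, E` are stated), and
`a_{φ j} → a₀` along a subsequence `φ`, then `A ≤ a₀` (apply the hypothesis to tails of `φ`, on
which `a_{φ j} ≤ M` for any `M > a₀`). [folklore] -/
theorem le_of_tendsto_of_forall_subseq_le {a : ℕ → ℝ≥0∞} {A a₀ : ℝ≥0∞} {φ : ℕ → ℕ}
    (hφ : StrictMono φ) (hta : Tendsto (fun j => a (φ j)) atTop (𝓝 a₀))
    (hA : ∀ ψ : ℕ → ℕ, StrictMono ψ → ∀ M : ℝ≥0∞, (∀ j, a (ψ j) ≤ M) → A ≤ M) : A ≤ a₀ := by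
  refine le_of_forall_gt_imp_ge_of_dense fun M hM => ?_
  obtain ⟨N, hN⟩ := eventually_atTop.1 (hta.eventually (ge_mem_nhds hM))
  exact hA (fun j => φ (j + N)) (fun i j hij => hφ (Nat.add_lt_add_right hij N)) M
    fun j => hN (j + N) (Nat.le_add_left N j)

/-- **Superadditivity of `liminf` for four lower semicontinuous functionals.**  If
`a_j + c_j + d_j + e_j ≤ I` for all `j` and the quantities `A, C, D, E ∈ ℝ≥0∞` are bounded by `M`
whenever a subsequence of `(a_j)`, `(c_j)`, `(d_j)`, `(e_j)` respectively is bounded by `M`, then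
`A + C + D + E ≤ I`: along a common subsequence (compactness of `ℝ≥0∞⁴`) the four sequences
converge to `a, c, d, e` with `a + c + d + e ≤ I`, and `A ≤ a`, `C ≤ c`, `D ≤ d`, `E ≤ e` by
`le_of_tendsto_of_forall_subseq_le`.  (This is the step "(3.6) follows from (3.3)" of
Albritton–Barker 2019, §3, with the sharp constant.) [folklore] -/
theorem add_add_add_le_of_forall_subseq_le {a c d e : ℕ → ℝ≥0∞} {A C D E I : ℝ≥0∞}
    (hsum : ∀ j, a j + c j + d j + e j ≤ I)
    (hA : ∀ ψ : ℕ → ℕ, StrictMono ψ → ∀ M : ℝ≥0∞, (∀ j, a (ψ j) ≤ M) → A ≤ M)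
    (hC : ∀ ψ : ℕ → ℕ, StrictMono ψ → ∀ M : ℝ≥0∞, (∀ j, c (ψ j) ≤ M) → C ≤ M)
    (hD : ∀ ψ : ℕ → ℕ, StrictMono ψ → ∀ M : ℝ≥0∞, (∀ j, d (ψ j) ≤ M) → D ≤ M)
    (hE : ∀ ψ : ℕ → ℕ, StrictMono ψ → ∀ M : ℝ≥0∞, (∀ j, e (ψ j) ≤ M) → E ≤ M) :
    A + C + D + E ≤ I := by
  -- a subsequence along which `(a, c, d, e)` converges in the compact space `ℝ≥0∞⁴`
  obtain ⟨⟨a₀, c₀, d₀, e₀⟩, φ, hφ, hlim⟩ :=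
    CompactSpace.tendsto_subseq (fun j => ((a j, c j, d j, e j) : ℝ≥0∞ × ℝ≥0∞ × ℝ≥0∞ × ℝ≥0∞))
  have ha : Tendsto (fun j => a (φ j)) atTop (𝓝 a₀) := hlim.fst_nhds
  have hc : Tendsto (fun j => c (φ j)) atTop (𝓝 c₀) := hlim.snd_nhds.fst_nhds
  have hd : Tendsto (fun j => d (φ j)) atTop (𝓝 d₀) := hlim.snd_nhds.snd_nhds.fst_nhds
  have he : Tendsto (fun j => e (φ j)) atTop (𝓝 e₀) := hlim.snd_nhds.snd_nhds.snd_nhds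
  -- the limits sum to at most `I`
  have hle : a₀ + c₀ + d₀ + e₀ ≤ I :=
    le_of_tendsto' (((ha.add hc).add hd).add he) fun j => hsum (φ j)
  -- lower semicontinuity of each functional along the common subsequence
  calc A + C + D + E ≤ a₀ + c₀ + d₀ + e₀ :=
        add_le_add (add_le_add (add_le_add (le_of_tendsto_of_forall_subseq_le hφ ha hA)
          (le_of_tendsto_of_forall_subseq_le hφ hc hC)) (le_of_tendsto_of_forall_subseq_le hφ hd hD))
          (le_of_tendsto_of_forall_subseq_le hφ he hE)
    _ ≤ I := hle

end LiminfTools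

section Engine

/-- **Compactness of Type-I-bounded suitable weak solutions on the backward slab, sharp form**
(Albritton–Barker 2019, §3: Lemma 2.2 + Prop. 2.3 + lower semicontinuity of `A + C + D + E`,
exhausted to the slab).  Suitable weak solutions `(v_k, q_k)` on `(-∞, 0) × ℝ³` with weak
gradients `G_k` and `𝐈(v_k, q_k, G_k) ≤ I < ∞` subconverge in `L³(Q(0, R))` for every `R > 0` to
a suitable weak solution `(u, p)` on the slab with a weak gradient `H` and `𝐈(u, p, H) ≤ I` (the
class `𝐈 ≤ I` is closed under such limits); if the approximants blow up in `L^∞(Q(0, R))` for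
every `R > 0` along the subsequence, the origin is a backward singular point of `u`.  (The limit
pressure is the weak `L^{3/2}_loc` limit of the pressures normalised to unit-ball mean zero.)
This sharpens `slab_typeI_compactness` (`𝐈 ≤ 4 I`) by bounding `A + C + D + E` on each admissible
ball jointly (`add_add_add_le_of_forall_subseq_le`) instead of term by term.
[cite: AlbrittonBarker2019, Lemma 2.2, Prop. 2.3 and §3] -/
theorem slab_typeI_compactness_sharp :
    ∀ (I : ℝ≥0∞) (v : ℕ → ℝ → EuclideanSpace ℝ (Fin 3) → EuclideanSpace ℝ (Fin 3))
      (q : ℕ → ℝ → EuclideanSpace ℝ (Fin 3) → ℝ)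
      (G : ℕ → ℝ → EuclideanSpace ℝ (Fin 3) → EuclideanSpace ℝ (Fin 3) →L[ℝ] EuclideanSpace ℝ (Fin 3)),
      I < ⊤ →
      (∀ k, IsSuitableWeakSolutionOn (slab (EuclideanSpace ℝ (Fin 3)) (Iio 0) isOpen_Iio) 1 0 (v k) (q k)) →
      (∀ k, HasWeakSpatialGradientOn (slab (EuclideanSpace ℝ (Fin 3)) (Iio 0) isOpen_Iio) (v k) (G k)) →
      (∀ k, typeIBound (Iio (0 : ℝ) ×ˢ univ) (v k) (q k) (G k) ≤ I) →
      ∃ (u : ℝ → EuclideanSpace ℝ (Fin 3) → EuclideanSpace ℝ (Fin 3))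
        (p : ℝ → EuclideanSpace ℝ (Fin 3) → ℝ)
        (H : ℝ → EuclideanSpace ℝ (Fin 3) → EuclideanSpace ℝ (Fin 3) →L[ℝ] EuclideanSpace ℝ (Fin 3))
        (σ : ℕ → ℕ),
        StrictMono σ ∧
        IsSuitableWeakSolutionOn (slab (EuclideanSpace ℝ (Fin 3)) (Iio 0) isOpen_Iio) 1 0 u p ∧
        HasWeakSpatialGradientOn (slab (EuclideanSpace ℝ (Fin 3)) (Iio 0) isOpen_Iio) u H ∧
        typeIBound (Iio (0 : ℝ) ×ˢ univ) u p H ≤ I ∧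
        (∀ R : ℝ, 0 < R → Tendsto (fun j => eLpNorm (uncurry (v (σ j)) - uncurry u) 3
          (volume.restrict (parabolicCylinder R (0 : ℝ × EuclideanSpace ℝ (Fin 3))))) atTop (𝓝 0)) ∧
        ((∀ R : ℝ, 0 < R → limsup (fun j => eLpNorm (uncurry (v (σ j))) ⊤
            (volume.restrict (parabolicCylinder R (0 : ℝ × EuclideanSpace ℝ (Fin 3))))) atTop = ⊤) →
          IsBackwardSingularPoint u 0) := by
  intro I v q G hI hsw hwg hbd
  have hItop : I ≠ ⊤ := hI.ne
  -- ## Step 0: normalise the pressures to unit-ball mean zero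
  set qn : ℕ → ℝ → EuclideanSpace ℝ (Fin 3) → ℝ :=
    fun k t x => q k t x - ⨍ y in ball (0 : EuclideanSpace ℝ (Fin 3)) 1, q k t y with hqn
  have hswn : ∀ k, IsSuitableWeakSolutionOn (slab (EuclideanSpace ℝ (Fin 3)) (Iio 0) isOpen_Iio)
      1 0 (v k) (qn k) := fun k => (hsw k).sub_unitBallMean_slab
  have hbdn : ∀ k, typeIBound (Iio (0 : ℝ) ×ˢ univ) (v k) (qn k) (G k) ≤ I := fun k => by
    show typeIBound (Iio (0 : ℝ) ×ˢ univ) (v k)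
      (fun t x => q k t x - ⨍ y in ball (0 : EuclideanSpace ℝ (Fin 3)) 1, q k t y) (G k) ≤ I
    rw [typeIBound_sub_unitBallMean (hsw k).distributional.2.2.1]
    exact hbd k
  have h0 : ∀ k t, ⨍ y in ball (0 : EuclideanSpace ℝ (Fin 3)) 1, qn k t y = 0 := fun k t =>
    unitBallMean_sub_unitBallMean (q k) t
  have hIk : ∀ k, typeIBound (Iio (0 : ℝ) ×ˢ univ) (v k) (qn k) (G k) ≠ ⊤ := fun k =>
    ne_top_of_le_ne_top hItop (hbdn k)
  have hqnli : ∀ k, LocallyIntegrableOn (uncurry (qn k))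
      (Iio (0 : ℝ) ×ˢ (univ : Set (EuclideanSpace ℝ (Fin 3)))) volume := fun k =>
    (hswn k).distributional.2.2.1
  -- ## Step 1: the hypotheses of the compactness theorem on the balls `Q(0, 2ᵐ)`
  have hball' : ∀ k (a : ℝ), 1 ≤ a → IsSuitableWeakSolutionInBall a 0 (v k) (qn k) := fun k a ha =>
    isSuitableWeakSolutionInBall_of_slab (hswn k) (hwg k) (hIk k) (h0 k) ha
  have hball : ∀ k (m : ℕ), IsSuitableWeakSolutionInBall ((2 : ℝ) ^ m) 0 (v k) (qn k) :=
    fun k m => hball' k _ (one_le_pow₀ (by norm_num))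
  have hbd2 : ∀ m : ℕ, (⨆ k, eLpNorm (uncurry (v k)) 3
        (volume.restrict (parabolicCylinder ((2 : ℝ) ^ m) (0 : ℝ × EuclideanSpace ℝ (Fin 3)))) +
      eLpNorm (uncurry (qn k)) (3 / 2)
        (volume.restrict (parabolicCylinder ((2 : ℝ) ^ m) (0 : ℝ × EuclideanSpace ℝ (Fin 3))))) < ∞ := by
    intro m
    have h2m : (1 : ℝ) ≤ 2 ^ m := one_le_pow₀ (by norm_num)
    have h2m0 : (0 : ℝ) < 2 ^ m := by positivity
    set Cv : ℝ≥0∞ := (ENNReal.ofReal ((2 : ℝ) ^ m) ^ 2 * I) ^ (1 / 3 : ℝ) with hCv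
    set Cq : ℝ≥0∞ := (2 * (1 + volume (ball (0 : EuclideanSpace ℝ (Fin 3)) ((2 : ℝ) ^ m)) *
        (volume (ball (0 : EuclideanSpace ℝ (Fin 3)) 1))⁻¹) *
      (ENNReal.ofReal ((2 : ℝ) ^ m) ^ 2 * I)) ^ (2 / 3 : ℝ) with hCq
    refine lt_of_le_of_lt (iSup_le fun k => add_le_add ?_ ?_) (b := Cv + Cq) ?_
    · refine (eLpNorm_velocity_slab_le h2m0 (qn k) (G k)).trans ?_
      exact ENNReal.rpow_le_rpow (mul_le_mul' le_rfl (hbdn k)) (by norm_num)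
    · refine (eLpNorm_pressure_slab_le (hqnli k) (h0 k) h2m (v k) (G k)).trans ?_
      exact ENNReal.rpow_le_rpow (mul_le_mul' le_rfl (mul_le_mul' le_rfl (hbdn k))) (by norm_num)
    · refine ENNReal.add_lt_top.2 ⟨?_, ?_⟩
      · exact ENNReal.rpow_lt_top_of_nonneg (by norm_num)
          (ENNReal.mul_ne_top (ENNReal.pow_ne_top ENNReal.ofReal_ne_top) hItop)
      · refine ENNReal.rpow_lt_top_of_nonneg (by norm_num) ?_
        rw [← mul_assoc]
        exact ENNReal.mul_ne_top (pressureConst_lt_top ((2 : ℝ) ^ m)).ne hItop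
  -- ## Step 2: the limit along one subsequence (A–B Lemma 2.2 on the expanding balls)
  obtain ⟨u, p, σ, hσ, hlim⟩ := slab_suitableCompactness hball hbd2
  -- ## Step 3: suitability on the slab and the weak gradient, by exhaustion
  have hswu : IsSuitableWeakSolutionOn (slab (EuclideanSpace ℝ (Fin 3)) (Iio 0) isOpen_Iio) 1 0 u p :=
    ESSBlowup.isSuitableWeakSolutionOn_halfspace fun a ha => (hlim a ha).1
  set Qn : ℕ → Opens (ℝ × EuclideanSpace ℝ (Fin 3)) :=
    fun n => parabolicCylinderOpens ((n : ℝ) + 1) (0 : ℝ × EuclideanSpace ℝ (Fin 3)) with hQn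
  have hmono : Monotone Qn := fun m n hmn z hz =>
    SuitableCompactness.parabolicCylinder_zero_mono (by positivity) (by simpa using hmn) hz
  have hcov : ∀ K ⊆ ((slab (EuclideanSpace ℝ (Fin 3)) (Iio 0) isOpen_Iio :
      Opens (ℝ × EuclideanSpace ℝ (Fin 3))) : Set (ℝ × EuclideanSpace ℝ (Fin 3))),
      IsCompact K → ∃ n, K ⊆ (Qn n : Set (ℝ × EuclideanSpace ℝ (Fin 3))) := fun K hK hKc =>
    ESSBlowup.exists_subset_parabolicCylinder_of_isCompact hK hKc
  choose Gn hGn hGn2 using fun n : ℕ => (hlim ((n : ℝ) + 1) (by positivity)).1.2.2.1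
  obtain ⟨H, hH, hHae⟩ := exists_hasWeakSpatialGradientOn_of_exhaustion
    (Q := slab (EuclideanSpace ℝ (Fin 3)) (Iio 0) isOpen_Iio) (Qn := Qn) hmono hcov hGn
  -- ## Step 4: `𝐈(u, p, H) ≤ I` by lower semicontinuity of `A + C + D + E` on every admissible
  -- ball (superadditivity of `liminf` along a common convergent subsequence)
  have hI' : typeIBound (Iio (0 : ℝ) ×ˢ univ) u p H ≤ I := by
    refine typeIBound_le_iff.2 fun r hr z hz => ?_
    -- an exhausting ball `Q₀ = Q(0, n + 1) ⊇ Q(z, r)`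
    obtain ⟨n, hn⟩ : ∃ n : ℕ, parabolicCylinder r z ⊆
        parabolicCylinder ((n : ℝ) + 1) (0 : ℝ × EuclideanSpace ℝ (Fin 3)) := by
      obtain ⟨n, hn⟩ := exists_nat_ge (max (r ^ 2 - z.1) (‖z.2‖ + r))
      refine ⟨n, fun w hw => ?_⟩
      have hw0 : w.1 < 0 := (hz hw).1
      rw [mem_parabolicCylinder] at hw
      rw [SuitableCompactness.mem_parabolicCylinder_zero]
      have h1 : r ^ 2 - z.1 ≤ n := (le_max_left _ _).trans hn
      have h2 : ‖z.2‖ + r ≤ n := (le_max_right _ _).trans hn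
      have h3 : (n : ℝ) ≤ ((n : ℝ) + 1) ^ 2 := by nlinarith [n.cast_nonneg (α := ℝ)]
      refine ⟨⟨by linarith [hw.1.1], hw0⟩, ?_⟩
      calc ‖w.2‖ = ‖(w.2 - z.2) + z.2‖ := by rw [sub_add_cancel]
        _ ≤ ‖w.2 - z.2‖ + ‖z.2‖ := norm_add_le _ _
        _ < r + ‖z.2‖ := by rw [← dist_eq_norm]; linarith [hw.2]
        _ ≤ (n : ℝ) + 1 := by linarith
    set a : ℝ := (n : ℝ) + 1 with ha
    have ha0 : 0 < a := by positivity
    have ha1 : 1 ≤ a := by rw [ha]; linarith [n.cast_nonneg (α := ℝ)]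
    set Q₀ : Set (ℝ × EuclideanSpace ℝ (Fin 3)) :=
      parabolicCylinder a (0 : ℝ × EuclideanSpace ℝ (Fin 3)) with hQ₀
    have hzQ : parabolicCylinder r z ⊆ Q₀ := hn
    obtain ⟨hballu, hum3, hconv, hweak⟩ := hlim a ha0
    have hQ₀s : Q₀ ⊆ Iio (0 : ℝ) ×ˢ (univ : Set (EuclideanSpace ℝ (Fin 3))) :=
      parabolicCylinder_subset_lowerHalf le_rfl a
    have hleΩ : parabolicCylinderOpens r z ≤
        (slab (EuclideanSpace ℝ (Fin 3)) (Iio 0) isOpen_Iio : Opens (ℝ × EuclideanSpace ℝ (Fin 3))) :=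
      fun w hw => hz hw
    -- the approximants along `σ`: `A_j + C_j + D_j + E_j ≤ I`
    have hsum : ∀ j, cknAEss r z (v (σ j)) + cknC r z (v (σ j)) + cknDOsc r z (qn (σ j)) +
        cknE r z (G (σ j)) ≤ I := fun j =>
      (abScaledSum_le_typeIBound hr hz).trans (hbdn (σ j))
    have hvm : ∀ j, AEStronglyMeasurable (uncurry (v (σ j))) (volume.restrict Q₀) := fun j =>
      (hwg (σ j)).locallyIntegrableOn.aestronglyMeasurable.mono_measure
        (Measure.restrict_mono hQ₀s le_rfl)
    have hum : AEStronglyMeasurable (uncurry u) (volume.restrict Q₀) := hum3.1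
    have hqmem : ∀ j, MemLp (uncurry (qn (σ j))) (3 / 2) (volume.restrict Q₀) := fun j =>
      (hball' (σ j) a ha1).2.2.2
    have hHfin : ∫⁻ w in parabolicCylinder r z, ENNReal.ofReal (frobeniusNormSq (H w.1 w.2)) < ∞ := by
      have e : ∫⁻ w in parabolicCylinder r z, ENNReal.ofReal (frobeniusNormSq (H w.1 w.2)) =
          ∫⁻ w in parabolicCylinder r z, ENNReal.ofReal (frobeniusNormSq (Gn n w.1 w.2)) := by
        refine setLIntegral_congr_of_ae_imp (isOpen_parabolicCylinder r z).measurableSet hzQ ?_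
        filter_upwards [hHae n] with w hw hwS
        have e : H w.1 w.2 = Gn n w.1 w.2 := hw hwS
        rw [e]
      rw [e]
      exact lt_of_le_of_lt (lintegral_mono_set hzQ) (hGn2 n)
    -- `A`, `C`, `D`, `E` are lower semicontinuous along every further subsequence `σ ∘ ψ`
    show cknAEss r z u + cknC r z u + cknDOsc r z p + cknE r z H ≤ I
    refine add_add_add_le_of_forall_subseq_le hsum (fun ψ hψ M hM => ?_) (fun ψ hψ M hM => ?_)
      (fun ψ hψ M hM => ?_) (fun ψ hψ M hM => ?_)
    · exact cknAEss_le_of_tendsto_eLpNorm hr hzQ (fun j => hvm (ψ j)) hum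
        (hconv.comp hψ.tendsto_atTop) hM
    · exact cknC_le_of_tendsto_eLpNorm hr hzQ (fun j => hvm (ψ j)) hum
        (hconv.comp hψ.tendsto_atTop) hM
    · exact cknDOsc_le_of_tendsto_weakly hr hzQ (fun j => hqmem (ψ j)) hballu.2.2.2
        (fun g hg => (hweak g hg).comp hψ.tendsto_atTop) hM
    · exact cknE_le_of_tendsto_eLpNorm hr hzQ (fun j => (hwg (σ (ψ j))).mono hleΩ) (hH.mono hleΩ)
        hHfin (hconv.comp hψ.tendsto_atTop) hM
  -- ## Step 5: persistence of singularities on `Q(0, 1)` (A–B Prop. 2.3)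
  have hpers : (∀ R : ℝ, 0 < R → limsup (fun j => eLpNorm (uncurry (v (σ j))) ⊤
      (volume.restrict (parabolicCylinder R (0 : ℝ × EuclideanSpace ℝ (Fin 3))))) atTop = ⊤) →
      IsBackwardSingularPoint u 0 := by
    intro hsup
    have hone : ∀ j, IsSuitableWeakSolutionInBall 1 0 (v (σ j)) (qn (σ j)) := fun j =>
      hball' (σ j) 1 le_rfl
    have hbd1 : (⨆ j, eLpNorm (uncurry (v (σ j))) 3
          (volume.restrict (parabolicCylinder 1 (0 : ℝ × EuclideanSpace ℝ (Fin 3)))) +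
        eLpNorm (uncurry (qn (σ j))) (3 / 2)
          (volume.restrict (parabolicCylinder 1 (0 : ℝ × EuclideanSpace ℝ (Fin 3))))) < ∞ := by
      have h := hbd2 0
      rw [pow_zero] at h
      refine lt_of_le_of_lt (iSup_le fun j => ?_) h
      exact le_iSup (fun k => eLpNorm (uncurry (v k)) 3
        (volume.restrict (parabolicCylinder 1 (0 : ℝ × EuclideanSpace ℝ (Fin 3)))) +
        eLpNorm (uncurry (qn k)) (3 / 2)
        (volume.restrict (parabolicCylinder 1 (0 : ℝ × EuclideanSpace ℝ (Fin 3))))) (σ j)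
    refine PersistenceOfSingularities_holds (fun j => v (σ j)) (fun j => qn (σ j)) u p hone hbd1
      (fun R hR => ?_) (fun R hR => hsup R hR.1)
    obtain ⟨h1, -, h3, h4⟩ := hlim R hR.1
    exact ⟨h1, h3, h4⟩
  exact ⟨u, p, H, σ, hσ, hswu, hH, hI', fun R hR => (hlim R hR).2.2.1, hpers⟩

end Engine

end Literature.Analysis.FluidPDE
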